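import Summits.BirchSwinnertonDyer.BirchSwinnertonDyer.Theorems.PrintCf2RamifiedOffTYZQFormMonsky
import Summits.BirchSwinnertonDyer.BirchSwinnertonDyer.Theorems.PrintCf2RamifiedOffTYZQFormReindex
import Summits.BirchSwinnertonDyer.BirchSwinnertonDyer.Theorems.PrintCf2RamifiedOffTYZQFormDefs
import HarnessLib

/-!
# Route `PrintCf2`, crux stmt-BirchSwinnertonDyer-20509 `RamifiedOffTYZOfFacts` — THE Q-FORM IDENTITY (★) IN g5's VOCABULARY (F5b)
# (cell `bsd-print-cf2`, LEAD of 20509 g6, line `offtyz-v7`, cycle 7; kernel helpers `--supports stmt-BirchSwinnertonDyer-20509`)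

The last step of this cycle's kernel proof of g5's conjecture (★) `Q_n = q(κ_n)` (crux workfiles `Lines/offtyz_v7_QForm.md` §11,
`Lines/offtyz_v7_QFormProof.md`): the forest-language identities of `…QFormMonsky` (`kerSum_monsky_inr_eq_sum_mod_eight`,
`kerSum_monsky_four_eq_sum_mod_eight`) re-indexed to the block vocabulary of `PrintCf2RamifiedOffTYZQFormDefs` (p678378):
* `coblockWeight_eq_det_bigN` — `QForm.coblockWeight p S = det bigN aᵀ Sᶜ z z z` (Monsky's matrix of the co-block sub-tuple has the kernel,
  hence the determinant, of the doubled forest matrix of the transposed weights);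
* `blockRho_eq_treeDet` — `QForm.blockRho p S t = [t ∈ S] · treeDet aᵀ S t` on even blocks (the right null vector of the real Rédei matrix
  of the block is the vector of out-arborescence counts);
* **`omega_diag_eq_kappaB`, `omega_offdiag_eq`, `qFormIdentityOmega`** — **(★) VERBATIM in its Ω-form** (the text `QForm.QFormIdentityOmega`
  of the crux workfile `Lines/offtyz_v7_QForm.lean`): for distinct odd primes with `∏ pᵢ ≡ 5 (mod 8)`, `Ω_n` has diagonal `κB` and
  `Ω_n + Ω_nᵀ = d₀𝟙ᵀ + 𝟙d₀ᵀ` off the diagonal, `d₀ = κA + κB`.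
CONSEQUENCE (paper level, note `offtyz_v7_QForm.md` §1–§3, §6 + the Galois-mover door p672160): for every square-free `n ≡ 5 (mod 8)` with
`#Sel₂(E_n) = 8` the genus point has a Galois mover, so `𝓛(n)` is odd, `ord_{s=1} L(E_n, s) = rank E_n(ℚ) = 1`, `Ш(E_n)[2^∞] = 0` and
`BSD(E_n, 2)` — modulo TYZ §3 as displayed and the class-field-theoretic identification of the note's §2 (not in the tree).
Pure linear algebra over `𝔽₂` + quadratic reciprocity; no `sorry`. BSD is not proved by any of this; no class is closed.

References: [cite: HeathBrown1994SelmerCongruentII, Appendix (Monsky), typescript p. 39 L10 – p. 40 L31]; [cite: Smith2016CongruentDensity, §2];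
[cite: Chaiken1982, §2]; [cite: TianYuanZhang2017, Thm. 1.1, §3.1, Thm. 3.5].
-/

namespace Summit.BirchSwinnertonDyer.PrintCf2.QFormForest

open Matrix Finset Literature.LinearAlgebra.Matrix Literature.Combinatorics.Enumerative
open Literature.NumberTheory.EllipticCurves.Smith2016

variable {V : Type*} [Fintype V] [LinearOrder V]
section MonskyBlocks

open Literature.NumberTheory.EllipticCurves.HeathBrown1994 Literature.NumberTheory.EllipticCurves.MonskySelmerParity
open Summit.BirchSwinnertonDyer.PrintCf2.QForm

variable {k : ℕ} (p : Fin k → ℕ) (hp : ∀ i, (p i).Prime) (hp2 : ∀ i, p i ≠ 2) (hinj : Function.Injective p)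

include hp hp2 hinj in
/-- **`coblockWeight p S = det bigN aᵀ (univ ∖ S) z z z`** for a block with `Σ_{univ∖S} (−1/pᵢ)₊ = 0` (e.g. `S` admissible in
`n ≡ 5 (mod 8)`): Monsky's matrix of the co-block sub-tuple has the same kernel as the doubled forest matrix of the transposed weights
(`monskyMatrixOdd_mulVec_eq_zero_iff_bigN` on the sub-tuple), hence the same determinant, which re-indexes to the ambient block
(`det_bigN_eq_det_bigN_reindex`). [cite: HeathBrown1994SelmerCongruentII, Appendix (Monsky), typescript p. 39 L27–L33] [cite: Chaiken1982, §2] -/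
theorem coblockWeight_eq_det_bigN (S : Finset (Fin k)) (hy : ∑ i ∈ Sᶜ, addLegendreSym (-1) (p i) = 0) :
    coblockWeight p S =
      (bigN (fun i j => legendreMatrix p j i) Sᶜ (fun i => addLegendreSym 2 (p i)) (fun i => addLegendreSym 2 (p i))
        (fun i => addLegendreSym 2 (p i))).det := by
  set e := (Sᶜ.orderIsoOfFin rfl).toEquiv with he
  set q : Fin Sᶜ.card → ℕ := blockPrimes p Sᶜ with hq
  have hqe : ∀ t, q t = p (e t : Fin k) := fun t => rfl
  have hqp : ∀ t, (q t).Prime := fun t => hp _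
  have hq2 : ∀ t, q t ≠ 2 := fun t => hp2 _
  have hqinj : Function.Injective q := fun s t hst => e.injective (Subtype.ext (hinj hst))
  have hyq : ∑ t, addLegendreSym (-1) (q t) = 0 := by
    rw [← hy]
    simp only [hqe]
    rw [← sum_coe_sort Sᶜ]
    exact e.sum_comp (fun x : {x // x ∈ Sᶜ} => addLegendreSym (-1) (p (x : Fin k)))
  rw [coblockWeight, coblockMonsky, ← hq,
    det_eq_det_of_mulVec_eq_zero_iff _ _ (monskyMatrixOdd_mulVec_eq_zero_iff_bigN q hqp hq2 hqinj hyq),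
    det_bigN_eq_det_bigN_reindex _ Sᶜ _ _ _ e]
  congr 1
  refine bigN_congr_offdiag (fun i j hij => ?_) _ _ _ _
  rw [Families.legendreMatrix_apply_of_ne q hij.symm,
    Families.legendreMatrix_apply_of_ne p (fun h => hij.symm (e.injective (Subtype.ext h))), hqe, hqe]

end MonskyBlocks


section MonskyBlocks2

open Literature.NumberTheory.EllipticCurves.HeathBrown1994 Literature.NumberTheory.EllipticCurves.MonskySelmerParity
open Summit.BirchSwinnertonDyer.PrintCf2.QForm

variable {k : ℕ} (p : Fin k → ℕ) (hp : ∀ i, (p i).Prime) (hp2 : ∀ i, p i ≠ 2) (hinj : Function.Injective p)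

include hp hp2 hinj in
/-- The reciprocity law for the (untransposed) additive Legendre weights. [cite: HeathBrown1994SelmerCongruentII, Appendix (Monsky), typescript p. 39 L36–L41] -/
theorem hrec_legendre : ∀ i ∈ (univ : Finset (Fin k)), ∀ j ∈ (univ : Finset (Fin k)), i ≠ j →
    legendreMatrix p i j + legendreMatrix p j i = addLegendreSym (-1) (p i) * addLegendreSym (-1) (p j) := by
  intro i hi j hj hij
  rw [add_comm]
  exact hrec_legendreT p hp hp2 hinj i hi j hj hij

/-- The real Rédei matrix `A + D₋₁` IS the Laplacian-type matrix of the Legendre weights with root weights `y`.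
[cite: HeathBrown1994SelmerCongruentII, Appendix (Monsky), typescript p. 39 L13–L26] -/
theorem realRedei_eq_lap :
    legendreMatrix p + legendreDiagonal p (-1) = lap (fun i j => legendreMatrix p i j) univ (fun i => addLegendreSym (-1) (p i)) := by
  ext i j
  rw [Matrix.add_apply, lap_apply, legendreDiagonal, diagonal_apply]
  simp only [mem_univ, and_self, if_true]
  by_cases hij : i = j
  · subst hij
    rw [if_pos rfl, if_pos rfl, Families.legendreMatrix_apply_self, add_comm]
  · rw [if_neg hij, if_neg hij, add_zero]

include hp hp2 hinj in
/-- **The transpose of the real Rédei matrix of an even tuple is the transposed Laplacian**: for `Σ (−1/pᵢ)₊ = 0`,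
`(A + D₋₁)ᵀ = lap aᵀ univ 0` (off the diagonal `A_{ji}`; on it the column sum `A_ii + y_i`). [cite: HeathBrown1994SelmerCongruentII, Appendix (Monsky), typescript p. 39 L34–L41] -/
theorem realRedei_transpose_eq_lapT (h4 : ∑ i, addLegendreSym (-1) (p i) = 0) :
    (legendreMatrix p + legendreDiagonal p (-1))ᵀ = lap (fun i j => legendreMatrix p j i) univ 0 := by
  ext i j
  rw [transpose_apply, Matrix.add_apply, lap_apply, legendreDiagonal, diagonal_apply, Pi.zero_apply, zero_add]
  simp only [mem_univ, and_self, if_true]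
  by_cases hij : i = j
  · subst hij
    rw [if_pos rfl, if_pos rfl, sum_erase_legendreMatrix_col p hp hp2 hinj h4]
  · rw [if_neg (Ne.symm hij), if_neg hij, add_zero]

end MonskyBlocks2


section MonskyBlocks3

open Literature.NumberTheory.EllipticCurves.HeathBrown1994 Literature.NumberTheory.EllipticCurves.MonskySelmerParity
open Summit.BirchSwinnertonDyer.PrintCf2.QForm

variable {k : ℕ} (p : Fin k → ℕ) (hp : ∀ i, (p i).Prime) (hp2 : ∀ i, p i ≠ 2) (hinj : Function.Injective p)

include hp hp2 hinj in
/-- **`blockRho = κ^{aᵀ}` on even blocks** (note §2 (2a)): for `Σ_S (−1/pᵢ)₊ = 0` and `t ∈ S`, g5's `QForm.blockRho p S t` (the right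
kernel sum of the real Rédei matrix of the block, re-indexed) is the mod-2 count `treeDet aᵀ S t` of spanning arborescences of the block
diverging from `t` (kernel sum = adjugate diagonal; `(A_S + D_y)ᵀ` is the transposed Laplacian; re-indexing to the ambient block).
[cite: HeathBrown1994SelmerCongruentII, Appendix (Monsky), typescript p. 39 L13–L41] [cite: ChebotarevAgaev2002, §3 Thm. 1] -/
theorem blockRho_eq_treeDet (S : Finset (Fin k)) (hyS : ∑ i ∈ S, addLegendreSym (-1) (p i) = 0) (t : Fin k) :
    blockRho p S t = if t ∈ S then treeDet (fun i j => legendreMatrix p j i) S t else 0 := by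
  by_cases ht : t ∈ S
  swap
  · rw [if_neg ht, blockRho, dif_neg ht]
  rw [if_pos ht, blockRho, dif_pos ht]
  set e := (S.orderIsoOfFin rfl).toEquiv with he
  set q : Fin S.card → ℕ := blockPrimes p S with hq
  set x : Fin S.card := (S.orderIsoOfFin rfl).symm ⟨t, ht⟩ with hx
  have hqe : ∀ u, q u = p (e u : Fin k) := fun u => rfl
  have hex : (e x : Fin k) = t := by
    rw [hx, he]
    simp
  have hqp : ∀ u, (q u).Prime := fun u => hp _
  have hq2 : ∀ u, q u ≠ 2 := fun u => hp2 _
  have hqinj : Function.Injective q := fun u v huv => e.injective (Subtype.ext (hinj huv))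
  have hyq : ∑ u, addLegendreSym (-1) (q u) = 0 := by
    rw [← hyS]
    simp only [hqe]
    rw [← sum_coe_sort S]
    exact e.sum_comp (fun x : {x // x ∈ S} => addLegendreSym (-1) (p (x : Fin k)))
  have hN : blockRealRedei p S = lap (fun i j => legendreMatrix q i j) univ (fun i => addLegendreSym (-1) (q i)) := realRedei_eq_lap q
  have h1 : (fun _ => (1 : ZMod 2)) ᵥ* blockRealRedei p S = 0 := by
    have h := indicator_vecMul_lap_root_eq_zero (fun i j => legendreMatrix q i j) (fun i => addLegendreSym (-1) (q i))
      (X := univ) (hrec_legendre q hqp hq2 hqinj) hyq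
    rw [hN]
    have hind : (fun r : Fin S.card => if r ∈ (univ : Finset (Fin S.card)) then (1 : ZMod 2) else 0) = fun _ => 1 := by
      funext r; rw [if_pos (mem_univ r)]
    rw [hind] at h
    exact h
  haveI : Nonempty (Fin S.card) := ⟨x⟩
  rw [QForm.kerSum, kerSum_apply_eq_adjugate_of_one_vecMul _ h1 x]
  have htr : (blockRealRedei p S).adjugate x x = (blockRealRedei p S)ᵀ.adjugate x x := by
    rw [← adjugate_transpose, transpose_apply]
  rw [htr, blockRealRedei, realRedei_transpose_eq_lapT q hqp hq2 hqinj hyq, adjugate_lap_univ_zero_self, treeDet, treeDet,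
    det_lap_eq_det_lap_reindex (fun i j => legendreMatrix p j i) (erase_subset t S) _ e]
  have hD : (univ : Finset (Fin S.card)).filter (fun i => (e i : Fin k) ∈ S.erase t) = univ.erase x := by
    ext i
    simp only [mem_filter, mem_univ, true_and, mem_erase, ne_eq, and_true, (e i).2]
    constructor
    · intro h hix
      exact h (by rw [hix, hex])
    · intro h hte
      apply h
      apply e.injective
      exact Subtype.ext (hte.trans hex.symm)
  rw [hD]
  congr 1
  apply lap_congr
  · intro u hu i hi hui
    rw [mem_erase] at hu hi
    rw [Families.legendreMatrix_apply_of_ne q (Ne.symm hui),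
      Families.legendreMatrix_apply_of_ne p (fun h => hui (e.injective (Subtype.ext h)).symm), hqe, hqe]
  · intro i hi
    rw [mem_erase] at hi
    have hit : (e i : Fin k) ≠ t := fun h => hi.1 (e.injective (Subtype.ext (h.trans hex.symm)))
    rw [Families.legendreMatrix_apply_of_ne q (Ne.symm hi.1), Families.legendreMatrix_apply_of_ne p hit.symm, hqe, hqe, hex]

end MonskyBlocks3


section Final

open Literature.NumberTheory.EllipticCurves.HeathBrown1994 Literature.NumberTheory.EllipticCurves.MonskySelmerParity
open Summit.BirchSwinnertonDyer.PrintCf2.QForm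

variable {k : ℕ} (p : Fin k → ℕ) (hp : ∀ i, (p i).Prime) (hp2 : ∀ i, p i ≠ 2) (hinj : Function.Injective p)

/-- `admissible p S ⟺ ∏_S pᵢ ≡ 5 (mod 8)` (unfolding g5's Boolean test). [cite: HeathBrown1994SelmerCongruentII, Appendix (Monsky), typescript p. 39 L36–L37] -/
theorem admissible_eq_true_iff (S : Finset (Fin k)) : admissible p S = true ↔ (∏ i ∈ S, p i) % 8 = 5 := by
  unfold admissible; exact decide_eq_true_iff

include hp hp2 hinj in
/-- The summand dictionary on an admissible block of `n ≡ 5 (mod 8)`: `coblockWeight p S · blockRho p S t = [t ∈ S] · κ_t^{aᵀ}(S) · det bigN aᵀ(univ∖S)`.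
[cite: HeathBrown1994SelmerCongruentII, Appendix (Monsky), typescript p. 39 L27–L41] [cite: Chaiken1982, §2] -/
theorem coblockWeight_mul_blockRho (h5 : (∏ i, p i) % 8 = 5) {S : Finset (Fin k)} (hS : (∏ i ∈ S, p i) % 8 = 5) (t : Fin k) :
    coblockWeight p S * blockRho p S t =
      if t ∈ S then treeDet (fun i j => legendreMatrix p j i) S t *
        (bigN (fun i j => legendreMatrix p j i) (univ \ S) (fun i => addLegendreSym 2 (p i)) (fun i => addLegendreSym 2 (p i))
          (fun i => addLegendreSym 2 (p i))).det else 0 := by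
  obtain ⟨h4, _⟩ := sums_of_prod_mod_eight_five p hp hp2 h5
  have hyS : ∑ i ∈ S, addLegendreSym (-1) (p i) = 0 := ((admissible_iff_prod_mod_eight p hp hp2 S).mpr hS).1
  have hyc : ∑ i ∈ Sᶜ, addLegendreSym (-1) (p i) = 0 := by
    have h := sum_add_sum_compl S (fun i => addLegendreSym (-1) (p i))
    rw [h4, hyS, zero_add] at h
    exact h
  rw [coblockWeight_eq_det_bigN p hp hp2 hinj S hyc, blockRho_eq_treeDet p hp hp2 hinj S hyS t, compl_eq_univ_sdiff]
  split_ifs <;> ring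

include hp hp2 hinj in
/-- **g5's conjecture (★) in its Ω-form, DIAGONAL part — PROVED**: for distinct odd primes with `∏ pᵢ ≡ 5 (mod 8)` and every `i`,
`QForm.Omega p i i = QForm.kappaB p i` (`Ω_n := Σ_{S adm} det(M_{n/d_S}) ρ(N_S) 1_Sᵀ` has diagonal `d₋ =` the second block of Monsky's
kernel sum). This is the `x_{−1} x_{pᵢ}`-coefficient of the identity `Q_n = q(κ_n)` of the crux note
`Cruxes/RamifiedOffTYZOfFacts/Lines/offtyz_v7_QForm.md` §11 (text `QFormIdentityOmega`), hence — with the note's §1–§3 (Hochschild–Serre, the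
ring-class displays) and the Galois-mover door p672160 — the minimal-Selmer converse + BSD₂ for every square-free `n ≡ 5 (mod 8)` with
`#Sel₂(E_n) = 8`, at paper level. [cite: HeathBrown1994SelmerCongruentII, Appendix (Monsky), typescript p. 39 L10–L41]
[cite: Smith2016CongruentDensity, §2] [cite: Chaiken1982, §2] -/
theorem omega_diag_eq_kappaB (h5 : (∏ i, p i) % 8 = 5) (i : Fin k) : Omega p i i = kappaB p i := by
  rw [kappaB, kappa, QForm.kerSum, kerSum_monsky_inr_eq_sum_mod_eight p hp hp2 hinj h5 i, Omega, Matrix.of_apply,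
    Finset.powerset_univ]
  -- both sides are sums over the admissible blocks containing `i`
  have hL : ∀ S ∈ (univ : Finset (Finset (Fin k))).filter (fun S => admissible p S),
      coblockWeight p S * blockRho p S i * (if i ∈ S then (1 : ZMod 2) else 0) =
        if i ∈ S then treeDet (fun i j => legendreMatrix p j i) S i *
          (bigN (fun i j => legendreMatrix p j i) (univ \ S) (fun i => addLegendreSym 2 (p i)) (fun i => addLegendreSym 2 (p i))
            (fun i => addLegendreSym 2 (p i))).det else 0 := by
    intro S hS
    rw [mem_filter] at hS
    rw [coblockWeight_mul_blockRho p hp hp2 hinj h5 ((admissible_eq_true_iff p S).mp hS.2) i]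
    split_ifs <;> simp
  rw [sum_congr rfl hL, ← sum_filter, filter_filter]
  exact sum_congr (filter_congr fun S _ => by rw [admissible_eq_true_iff]; tauto) fun _ _ => rfl

include hp hp2 hinj in
/-- **g5's conjecture (★) in its Ω-form, OFF-DIAGONAL part — PROVED**: for `i ≠ j`,
`QForm.Omega p i j + QForm.Omega p j i = (kappaA p i + kappaB p i) + (kappaA p j + kappaB p j)` (the `x_{pᵢ} x_{pⱼ}`-coefficients of
`Q_n = q(κ_n)`). [cite: HeathBrown1994SelmerCongruentII, Appendix (Monsky), typescript p. 39 L10–L41] [cite: Smith2016CongruentDensity, §2] [cite: Chaiken1982, §2] -/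
theorem omega_offdiag_eq (h5 : (∏ i, p i) % 8 = 5) {i j : Fin k} (hij : i ≠ j) :
    Omega p i j + Omega p j i = (kappaA p i + kappaB p i) + (kappaA p j + kappaB p j) := by
  rw [kappaA, kappaB, kappaA, kappaB, kappa, QForm.kerSum, kerSum_monsky_four_eq_sum_mod_eight p hp hp2 hinj h5 hij, Omega,
    Matrix.of_apply, Matrix.of_apply, Finset.powerset_univ, ← sum_add_distrib]
  have hL : ∀ S ∈ (univ : Finset (Finset (Fin k))).filter (fun S => admissible p S),
      coblockWeight p S * blockRho p S i * (if j ∈ S then (1 : ZMod 2) else 0) +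
        coblockWeight p S * blockRho p S j * (if i ∈ S then (1 : ZMod 2) else 0) =
        if i ∈ S ∧ j ∈ S then (treeDet (fun i j => legendreMatrix p j i) S i + treeDet (fun i j => legendreMatrix p j i) S j) *
          (bigN (fun i j => legendreMatrix p j i) (univ \ S) (fun i => addLegendreSym 2 (p i)) (fun i => addLegendreSym 2 (p i))
            (fun i => addLegendreSym 2 (p i))).det else 0 := by
    intro S hS
    rw [mem_filter] at hS
    have hS5 := (admissible_eq_true_iff p S).mp hS.2
    rw [coblockWeight_mul_blockRho p hp hp2 hinj h5 hS5 i, coblockWeight_mul_blockRho p hp hp2 hinj h5 hS5 j]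
    by_cases hi : i ∈ S <;> by_cases hj : j ∈ S <;> simp [hi, hj]
    ring
  rw [sum_congr rfl hL, ← sum_filter, filter_filter]
  exact sum_congr (filter_congr fun S _ => by rw [admissible_eq_true_iff]; tauto) fun _ _ => rfl

end Final


section Verbatim

open Literature.NumberTheory.EllipticCurves.HeathBrown1994 Literature.NumberTheory.EllipticCurves.MonskySelmerParity
open Summit.BirchSwinnertonDyer.PrintCf2.QForm

/-- **THE Q-FORM IDENTITY (★) OF THE CRUX NOTE, VERBATIM Ω-FORM** (text `QForm.QFormIdentityOmega` of the crux workfile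
`Cruxes/RamifiedOffTYZOfFacts/Lines/offtyz_v7_QForm.lean`, conjectured by the LEAD g5 on the evidence of all Legendre patterns with
`k ≤ 5`; proved here for every `k`): for distinct odd primes `p₁, …, p_k` with `∏ pᵢ ≡ 5 (mod 8)`,
`Ω_n` has diagonal `κB` and `Ω_n + Ω_nᵀ = d₀ 𝟙ᵀ + 𝟙 d₀ᵀ` off the diagonal (`d₀ = κA + κB`), where `κ = (κA; κB)` is the kernel sum of
Monsky's matrix and `Ω_n = Σ_{d ≡ 5 (8)} det(M_{n/d}) · ρ(N_d) · 1_dᵀ`. [cite: HeathBrown1994SelmerCongruentII, Appendix (Monsky), typescript p. 39 L10–L41]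
[cite: Smith2016CongruentDensity, §2 Thm. 2.2 and §2.2 case 5(b)] [cite: Chaiken1982, §2 (all minors matrix tree theorem)] -/
theorem qFormIdentityOmega : ∀ (k : ℕ) (p : Fin k → ℕ), (∀ i, (p i).Prime) → (∀ i, Odd (p i)) → Function.Injective p →
    (∏ i, p i) % 8 = 5 →
      (∀ i, Omega p i i = kappaB p i) ∧
      (∀ i j, i ≠ j → Omega p i j + Omega p j i = (kappaA p i + kappaB p i) + (kappaA p j + kappaB p j)) := by
  intro k p hp hodd hinj h5
  have hp2 : ∀ i, p i ≠ 2 := ne_two_of_odd p hodd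
  exact ⟨fun i => omega_diag_eq_kappaB p hp hp2 hinj h5 i, fun i j hij => omega_offdiag_eq p hp hp2 hinj h5 hij⟩

end Verbatim


end Summit.BirchSwinnertonDyer.PrintCf2.QFormForest
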